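import Summits.ValiantsHypothesis.ValiantsHypothesis.Theorems.KPlusLogSqLawTropicalCycleMonotone
import Summits.ValiantsHypothesis.ValiantsHypothesis.Theorems.KPlusLogSqLawTropicalBCyclePotentialTransfer

/-!
# Route «KPlusLogSqLaw», crux `TropicalB` (stmt-ValiantsHypothesis-19771) — THE CYCLE POTENTIAL LAW: in ANY design, a dominant chain
# whose exchange orbits are short climbs a bounded class potential; `c`-lacunary exponents ⇒ `n ≤ m·((c+1)^(K−1) − 1)`

HONEST FRAMING.  Helper toward the registered stubs `stub_tropThin` / `stub_tropFat` of `Cruxes/TropicalB/Lines/birth.lean` (crux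
`Summit.ValiantsHypothesis.ValiantsHypothesis.Theses.KPlusLogSqLaw.TropicalB`, item stmt-ValiantsHypothesis-19771, route KPlusLogSqLaw;
cell `pub-symmetroid`, seat val-sym-trop-p1 g24, 2026-08-29; `--supports … --as helper`).  A STRUCTURE LAW about dominant chains of
ARBITRARY dominance designs (any support, any valuations, any exponents), with a CHAIN-CLASS hypothesis (short exchange orbits); it
bounds nothing for `TropicalB` in its window, and bears on neither `WeakLifting`, DoorA26 / DoorA34, `MatrixDescartes`
(stmt-ValiantsHypothesis-18050) nor VP ≠ VNP.

THE LAW.  Let `p = (σ₁, λ₁)` be dominant at `θ₁` and `p' = (σ₂, λ₂) ≠ p` dominant at `θ₂ > θ₁` in a design `(d, v, ε)` of format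
`(m, K)`.  The tree's CYCLEWISE MONOTONICITY (`sum_d_lt_of_isDominant_invariant`, …TropicalCycleMonotone) says that on every column
set `T` invariant under the quotient `σ₁⁻¹σ₂` on which the two terms differ, the exponent mass strictly rises.  Call a class potential
`u : Fin K → ℤ` `c`-COMPATIBLE with `d` if for every column set `B` with `#B ≤ c` and all class maps `f g`,
`Σ_{b∈B} d (f b) < Σ_{b∈B} d (g b) ⇒ Σ_{b∈B} u (f b) < Σ_{b∈B} u (g b)` (the strict order of `d`-sums and of `u`-sums agree on
multisets of at most `c` classes).  Then:

* `potential_step` — if every column lies in an invariant set of size `≤ c` (equivalently: every orbit of `σ₁⁻¹σ₂` has at most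
  `c` columns), the column potential `Φ = Σ_b u(class of b)` satisfies `Φ(p) + 1 ≤ Φ(p')` (split the columns into invariant pieces
  of size `≤ c`; each piece on which the terms differ gains `≥ 1`, the others gain `0`);
* `chain_le` / `chain_le_alt` — **every chain of terms dominant at strictly increasing slopes, consecutive terms distinct (resp.
  sign-alternating), all of whose consecutive exchange quotients have orbits of size `≤ c`, has `n ≤ m·(U₁ − U₀)`** for any
  `c`-compatible `u` with values in `[U₀, U₁]` — whatever the design;
* `chain_le_of_exceptions` — with an exceptional set `J` of steps (orbits unrestricted there): `n + 1 ≤ (#J + 1)·(m(U₁ − U₀) + 1)`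
  (the potential drops by at most `m(U₁ − U₀)` at any step), i.e. a chain of `n + 1` terms has `≥ (n+1)/(m(U₁−U₀)+1) − 1` steps with an
  orbit of more than `c` columns.

INSTANCES.  (1) part 1 (`…TropicalBCyclePotentialTransfer`, `CyclePotential.lacunary_transfer` / `col_transfer`): if the exponent VALUES are `c`-LACUNARY (`d l < d l' ⇒ c·d l < d l'`) then
EVERY `c`-lacunary re-weighting of the values is `c`-compatible — all `c`-lacunary weightings induce the same strict order on pairs
of class multisets of size `≤ c` (proof: peel the largest value; the side with more copies of it wins under any `c`-lacunary
weighting).  With the rank re-weighting `(c+1)^{rank}` (`exists_compatible_potential`), of height `(c+1)^{K−1} − 1`: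
`chain_le_lacunary` — **in a `c`-lacunary design every dominant chain whose exchange orbits have size `≤ c` has
`n ≤ m·((c+1)^(K−1) − 1)`** (`chain_le_lacunary_of_exceptions`: `n + 1 ≤ (#J+1)(m((c+1)^(K−1) − 1) + 1)` with exceptional steps `J`);
`chain_le_lacunary_of_shortSteps` — the same when every step changes at most `c` columns (the changed set of a step is invariant, unchanged
columns are fixed points).  This generalises the tree's lex short-step law
(`TropicalCensus.steps_le_of_shortSteps`, …TropicalBShortSteps: exponents super-increasing BY THE SIZE `m`, steps changing `≤ ℓ`
columns, `n ≤ m(ℓ+1)^K`) in three directions: the lacunarity threshold is the STEP SIZE `c`, not the format size; the hypothesis is on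
ORBIT LENGTH (a step may move every column, by many short cycles); the exponent is `K − 1`.  (2) Degenerate checks (docstring only):
`u = d` is `c`-compatible for every `c` (the degree bound `n ≤ m·(max d − min d)`, …TropicalBThinRanges); for exponents in an
arithmetic progression `d l = d₀ + a(l)·g` the digit map `a` is compatible (`n ≤ m·max a`, …TropicalBSumset).

READING (construction side, located in the tree's vocabulary; nothing claimed about `TropicalB`): in a `c`-lacunary design a chain longer
than `m·(c+1)^{K−1}` contains a step whose exchange quotient has an orbit of MORE than `c` columns — long chains need LONG CYCLES, not
merely many changed columns (cf. the single-cycle carry law …TropicalBCarryCycle in the lex sector: a full carry is one cycle through all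
lower-digit columns).  For general exponents the law holds with any `c`-compatible `u`; the least height of such a `u` is an invariant of
the order type of `d` on `c`-multisets (not bounded here).
[this file; part 1 = …TropicalBCyclePotentialTransfer (same seat); cyclewise monotonicity = …TropicalCycleMonotone (conjb-2 g4 / val-sym-trop-p4 g2)]
-/

set_option linter.dupNamespace false
set_option autoImplicit false

namespace Summit.ValiantsHypothesis.ValiantsHypothesis.Theorems.KPlusLogSqLaw

open Summit.ValiantsHypothesis.ValiantsHypothesis.Theorems.MatrixDescartes.Negative
open scoped BigOperators
open Finset

namespace CyclePotential

/-! ## 3. The potential step and the chain law (ANY design) -/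

section Chain

variable {m K : ℕ} (d : Fin K → ℕ) (v ε : Fin m → Fin m → Fin K → ℤ)

/-- **Invariant pieces.**  Let `(σ₁, λ₁)` be dominant at `θ₁` and `(σ₂, λ₂)` dominant at `θ₂ > θ₁`, let `u` be `c`-compatible with `d`, and let
every column lie in a `σ₁⁻¹σ₂`-invariant set of at most `c` columns.  Then on every invariant column set `W` the `u`-mass of `λ₂` is at least
that of `λ₁`, plus one if the two terms differ somewhere on `W` (strong induction on `W`: split off the invariant piece of size `≤ c` through a
column where they differ — there the `d`-mass rises by cyclewise monotonicity, hence the `u`-mass rises — and recurse on the rest). [this file] -/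
theorem potential_invariant (c : ℕ) (u : Fin K → ℤ)
    (hu : ∀ B : Finset (Fin m), B.card ≤ c → ∀ f g : Fin m → Fin K,
      ∑ b ∈ B, (d (f b) : ℤ) < ∑ b ∈ B, (d (g b) : ℤ) → ∑ b ∈ B, u (f b) < ∑ b ∈ B, u (g b))
    {θ₁ θ₂ : ℤ} (hθ : θ₁ < θ₂) {σ₁ σ₂ : Equiv.Perm (Fin m)} {l₁ l₂ : Fin m → Fin K}
    (h₁ : IsDominant d v ε θ₁ (σ₁, l₁)) (h₂ : IsDominant d v ε θ₂ (σ₂, l₂))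
    (horb : ∀ b, ∃ T : Finset (Fin m), b ∈ T ∧ T.card ≤ c ∧ ∀ x, (σ₁⁻¹ * σ₂) x ∈ T ↔ x ∈ T)
    (W : Finset (Fin m)) (hW : ∀ x, (σ₁⁻¹ * σ₂) x ∈ W ↔ x ∈ W) :
    ∑ b ∈ W, u (l₁ b) + (if ∃ b ∈ W, σ₁ b ≠ σ₂ b ∨ l₁ b ≠ l₂ b then 1 else 0) ≤ ∑ b ∈ W, u (l₂ b) := by
  classical
  induction W using Finset.strongInduction with
  | H W ih =>
    by_cases hdiff : ∃ b ∈ W, σ₁ b ≠ σ₂ b ∨ l₁ b ≠ l₂ b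
    · rw [if_pos hdiff]
      obtain ⟨b₀, hb₀W, hb₀⟩ := hdiff
      obtain ⟨T₀, hb₀T₀, hT₀c, hT₀⟩ := horb b₀
      -- the piece `W ∩ T₀` (invariant, small, contains a difference) and the rest `W \ T₀` (invariant, smaller)
      have hT : ∀ x, (σ₁⁻¹ * σ₂) x ∈ W ∩ T₀ ↔ x ∈ W ∩ T₀ := fun x => by rw [mem_inter, mem_inter, hW x, hT₀ x]
      have hR : ∀ x, (σ₁⁻¹ * σ₂) x ∈ W \ T₀ ↔ x ∈ W \ T₀ := fun x => by rw [mem_sdiff, mem_sdiff, hW x, hT₀ x]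
      have hTc : (W ∩ T₀).card ≤ c := (card_le_card inter_subset_right).trans hT₀c
      have hTd : ∃ b ∈ W ∩ T₀, σ₁ b ≠ σ₂ b ∨ l₁ b ≠ l₂ b := ⟨b₀, mem_inter.mpr ⟨hb₀W, hb₀T₀⟩, hb₀⟩
      have hstepd := sum_d_lt_of_isDominant_invariant d v ε hθ h₁ h₂ (W ∩ T₀) hT hTd
      have hstep : ∑ b ∈ W ∩ T₀, u (l₁ b) < ∑ b ∈ W ∩ T₀, u (l₂ b) := hu _ hTc l₁ l₂ hstepd
      have hss : W \ T₀ ⊂ W := by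
        rw [Finset.ssubset_iff_subset_ne]
        refine ⟨sdiff_subset, fun h => ?_⟩
        have hb : b₀ ∈ W \ T₀ := by rw [h]; exact hb₀W
        exact (mem_sdiff.mp hb).2 hb₀T₀
      have hrest := ih (W \ T₀) hss hR
      have hrest' : ∑ b ∈ W \ T₀, u (l₁ b) ≤ ∑ b ∈ W \ T₀, u (l₂ b) :=
        le_trans (le_add_of_nonneg_right (by split_ifs <;> norm_num)) hrest
      rw [← sum_inter_add_sum_sdiff W T₀ (fun b => u (l₁ b)), ← sum_inter_add_sum_sdiff W T₀ (fun b => u (l₂ b))]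
      linarith
    · rw [if_neg hdiff, add_zero]
      push Not at hdiff
      exact le_of_eq (sum_congr rfl fun b hb => by rw [(hdiff b hb).2])

/-- **Potential step.**  Between two DISTINCT terms dominant at `θ₁ < θ₂` whose exchange quotient `σ₁⁻¹σ₂` has all orbits of size `≤ c` (every
column lies in an invariant set of `≤ c` columns), the column potential `Σ_b u(class of b)` of any `c`-compatible `u` rises by at least one.
[this file] -/
theorem potential_step (c : ℕ) (u : Fin K → ℤ)
    (hu : ∀ B : Finset (Fin m), B.card ≤ c → ∀ f g : Fin m → Fin K,
      ∑ b ∈ B, (d (f b) : ℤ) < ∑ b ∈ B, (d (g b) : ℤ) → ∑ b ∈ B, u (f b) < ∑ b ∈ B, u (g b))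
    {θ₁ θ₂ : ℤ} (hθ : θ₁ < θ₂) {p₁ p₂ : Equiv.Perm (Fin m) × (Fin m → Fin K)}
    (h₁ : IsDominant d v ε θ₁ p₁) (h₂ : IsDominant d v ε θ₂ p₂) (hne : p₁ ≠ p₂)
    (horb : ∀ b, ∃ T : Finset (Fin m), b ∈ T ∧ T.card ≤ c ∧ ∀ x, (p₁.1⁻¹ * p₂.1) x ∈ T ↔ x ∈ T) :
    ∑ b, u (p₁.2 b) + 1 ≤ ∑ b, u (p₂.2 b) := by
  classical
  obtain ⟨σ₁, l₁⟩ := p₁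
  obtain ⟨σ₂, l₂⟩ := p₂
  have h := potential_invariant d v ε c u hu hθ h₁ h₂ horb univ (fun x => by simp)
  have hdiff : ∃ b ∈ (univ : Finset (Fin m)), σ₁ b ≠ σ₂ b ∨ l₁ b ≠ l₂ b := by
    by_contra hcon
    push Not at hcon
    apply hne
    have hσ : σ₁ = σ₂ := Equiv.ext fun b => (hcon b (mem_univ b)).1
    have hl : l₁ = l₂ := funext fun b => (hcon b (mem_univ b)).2
    rw [hσ, hl]
  rw [if_pos hdiff] at h
  exact h

/-- consecutive terms of a sign-alternating chain are distinct. [folklore; cf. `SeparatedLex.ne_of_termSign_mul_neg`] -/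
theorem ne_of_alt {n : ℕ} (p : Fin (n + 1) → Equiv.Perm (Fin m) × (Fin m → Fin K))
    (halt : ∀ k : Fin n, termSign ε (p k.castSucc) * termSign ε (p k.succ) < 0) (k : Fin n) :
    p k.castSucc ≠ p k.succ := fun hk => by
  have h := halt k
  rw [hk] at h
  exact absurd h (not_lt.mpr (mul_self_nonneg _))

/-! ### Few long steps: the law with exceptions -/

/-- one-step bound on the potential drop: `|Φ(p) − Φ(p')| ≤ m·(U₁ − U₀)` for any two terms. [this file] -/
theorem potential_drop_le (u : Fin K → ℤ) (U₀ U₁ : ℤ) (hU : ∀ l, U₀ ≤ u l ∧ u l ≤ U₁) (l₁ l₂ : Fin m → Fin K) :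
    ∑ b, u (l₁ b) - (m : ℤ) * (U₁ - U₀) ≤ ∑ b, u (l₂ b) := by
  have h1 : ∑ b, u (l₁ b) ≤ ∑ _b : Fin m, U₁ := Finset.sum_le_sum fun b _ => (hU _).2
  have h2 : ∑ _b : Fin m, U₀ ≤ ∑ b, u (l₂ b) := Finset.sum_le_sum fun b _ => (hU _).1
  simp only [sum_const, card_univ, Fintype.card_fin, nsmul_eq_mul] at h1 h2
  linarith

/-- **CYCLE POTENTIAL LAW WITH EXCEPTIONS (any design).**  If all steps of the chain OUTSIDE an exceptional index set `J` have exchange orbits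
of size `≤ c`, then `n + 1 ≤ (#J + 1)·(m·(U₁ − U₀) + 1)`: the potential rises by one at every ordinary step and drops by at most `m(U₁ − U₀)` at
an exceptional one.  Contrapositive reading: a chain of `n + 1` terms has at least `(n+1)/(m(U₁−U₀)+1) − 1` steps with an orbit of MORE than `c`
columns. [this file] -/
theorem chain_le_of_exceptions (c : ℕ) (u : Fin K → ℤ)
    (hu : ∀ B : Finset (Fin m), B.card ≤ c → ∀ f g : Fin m → Fin K,
      ∑ b ∈ B, (d (f b) : ℤ) < ∑ b ∈ B, (d (g b) : ℤ) → ∑ b ∈ B, u (f b) < ∑ b ∈ B, u (g b))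
    (U₀ U₁ : ℤ) (hU : ∀ l, U₀ ≤ u l ∧ u l ≤ U₁)
    {n : ℕ} (θ : Fin (n + 1) → ℤ) (p : Fin (n + 1) → Equiv.Perm (Fin m) × (Fin m → Fin K))
    (hθ : StrictMono θ) (hdom : ∀ k, IsDominant d v ε (θ k) (p k)) (hne : ∀ k : Fin n, p k.castSucc ≠ p k.succ)
    (J : Finset (Fin n))
    (horb : ∀ k : Fin n, k ∉ J → ∀ b : Fin m, ∃ T : Finset (Fin m), b ∈ T ∧ T.card ≤ c ∧
      ∀ x, ((p k.castSucc).1⁻¹ * (p k.succ).1) x ∈ T ↔ x ∈ T) :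
    (n : ℤ) + 1 ≤ (J.card + 1) * ((m : ℤ) * (U₁ - U₀) + 1) := by
  classical
  set H : ℤ := (m : ℤ) * (U₁ - U₀) with hH
  have hH0 : 0 ≤ H := by
    rcases Nat.eq_zero_or_pos m with hm | hm
    · simp [hH, hm]
    · have := hU ((p 0).2 ⟨0, hm⟩)
      have h01 : U₀ ≤ U₁ := this.1.trans this.2
      exact mul_nonneg (by positivity) (by linarith)
  -- the potential climbs by one at ordinary steps and drops by at most `H` at exceptional ones
  have hclimb : ∀ i : ℕ, ∀ hi : i ≤ n,
      (∑ b, u ((p 0).2 b)) + i ≤ ∑ b, u ((p ⟨i, Nat.lt_succ_of_le hi⟩).2 b) +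
        (H + 1) * ((J.filter fun k : Fin n => (k : ℕ) < i).card : ℤ) := by
    intro i
    induction i with
    | zero => intro hi; simp
    | succ i ih =>
      intro hi
      have h1 := ih (Nat.le_of_succ_le hi)
      have hk : (⟨i, by omega⟩ : Fin (n + 1)) = (⟨i, by omega⟩ : Fin n).castSucc := rfl
      have hk' : (⟨i + 1, Nat.lt_succ_of_le hi⟩ : Fin (n + 1)) = (⟨i, by omega⟩ : Fin n).succ := rfl
      -- the filter grows by the index `i` exactly when `i ∈ J`
      have hfilt : (J.filter fun k : Fin n => (k : ℕ) < i + 1) =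
          (J.filter fun k : Fin n => (k : ℕ) < i) ∪ (J.filter fun k : Fin n => k = ⟨i, by omega⟩) := by
        ext k
        simp only [mem_filter, mem_union, Fin.ext_iff]
        constructor
        · rintro ⟨hkJ, hk⟩
          rcases Nat.lt_succ_iff_lt_or_eq.mp hk with h | h
          · exact Or.inl ⟨hkJ, h⟩
          · exact Or.inr ⟨hkJ, h⟩
        · rintro (⟨hkJ, hk⟩ | ⟨hkJ, hk⟩)
          · exact ⟨hkJ, Nat.lt_succ_of_lt hk⟩
          · exact ⟨hkJ, by omega⟩
      have hdisj : Disjoint (J.filter fun k : Fin n => (k : ℕ) < i) (J.filter fun k : Fin n => k = ⟨i, by omega⟩) := by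
        rw [Finset.disjoint_filter]
        intro k _ hk heq
        rw [heq] at hk
        exact lt_irrefl _ hk
      rw [hfilt, card_union_of_disjoint hdisj]
      by_cases hiJ : (⟨i, by omega⟩ : Fin n) ∈ J
      · -- exceptional step: the potential drops by at most `H`, the counter gains `H + 1`
        have hone : (J.filter fun k : Fin n => k = ⟨i, by omega⟩).card = 1 := by
          rw [Finset.filter_eq' J (⟨i, by omega⟩ : Fin n), if_pos hiJ, card_singleton]
        have hdrop := potential_drop_le u U₀ U₁ hU ((p ⟨i, by omega⟩).2) ((p ⟨i + 1, Nat.lt_succ_of_le hi⟩).2)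
        rw [hone]
        push_cast
        linarith
      · -- ordinary step: the potential climbs
        have hzero : (J.filter fun k : Fin n => k = ⟨i, by omega⟩).card = 0 := by
          rw [Finset.filter_eq' J (⟨i, by omega⟩ : Fin n), if_neg hiJ, card_empty]
        have hstep := potential_step d v ε c u hu (hθ (Fin.castSucc_lt_succ (i := ⟨i, by omega⟩)))
          (hdom _) (hdom _) (hne ⟨i, by omega⟩) (horb ⟨i, by omega⟩ hiJ)
        rw [← hk, ← hk'] at hstep
        rw [hzero]
        push_cast
        linarith
  have hlast := hclimb n le_rfl
  have hJ : ((J.filter fun k : Fin n => (k : ℕ) < n).card : ℤ) ≤ J.card := by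
    exact_mod_cast card_filter_le _ _
  have hends := potential_drop_le u U₀ U₁ hU ((p ⟨n, Nat.lt_succ_self n⟩).2) ((p 0).2)
  have hJ0 : (0 : ℤ) ≤ J.card := by positivity
  nlinarith

/-- **CYCLE POTENTIAL LAW (any design).**  Every chain of terms dominant at strictly increasing slopes, consecutive terms distinct, all of
whose consecutive exchange quotients `σ_k⁻¹σ_{k+1}` have orbits of size `≤ c` (every column lies in an invariant set of `≤ c` columns), has
`n ≤ m·(U₁ − U₀)` for every `c`-compatible class potential `u` with values in `[U₀, U₁]` (the case `J = ∅` of `chain_le_of_exceptions`). [this file] -/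
theorem chain_le (c : ℕ) (u : Fin K → ℤ)
    (hu : ∀ B : Finset (Fin m), B.card ≤ c → ∀ f g : Fin m → Fin K,
      ∑ b ∈ B, (d (f b) : ℤ) < ∑ b ∈ B, (d (g b) : ℤ) → ∑ b ∈ B, u (f b) < ∑ b ∈ B, u (g b))
    (U₀ U₁ : ℤ) (hU : ∀ l, U₀ ≤ u l ∧ u l ≤ U₁)
    {n : ℕ} (θ : Fin (n + 1) → ℤ) (p : Fin (n + 1) → Equiv.Perm (Fin m) × (Fin m → Fin K))
    (hθ : StrictMono θ) (hdom : ∀ k, IsDominant d v ε (θ k) (p k)) (hne : ∀ k : Fin n, p k.castSucc ≠ p k.succ)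
    (horb : ∀ k : Fin n, ∀ b : Fin m, ∃ T : Finset (Fin m), b ∈ T ∧ T.card ≤ c ∧
      ∀ x, ((p k.castSucc).1⁻¹ * (p k.succ).1) x ∈ T ↔ x ∈ T) :
    (n : ℤ) ≤ m * (U₁ - U₀) := by
  have h := chain_le_of_exceptions d v ε c u hu U₀ U₁ hU θ p hθ hdom hne ∅ (fun k _ b => horb k b)
  simp only [card_empty, Nat.cast_zero, zero_add, one_mul] at h
  linarith

/-- **The law for sign-alternating chains** (the hypothesis list of `TropicalCensus.TropRootLawAt`). [this file] -/
theorem chain_le_alt (c : ℕ) (u : Fin K → ℤ)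
    (hu : ∀ B : Finset (Fin m), B.card ≤ c → ∀ f g : Fin m → Fin K,
      ∑ b ∈ B, (d (f b) : ℤ) < ∑ b ∈ B, (d (g b) : ℤ) → ∑ b ∈ B, u (f b) < ∑ b ∈ B, u (g b))
    (U₀ U₁ : ℤ) (hU : ∀ l, U₀ ≤ u l ∧ u l ≤ U₁)
    {n : ℕ} (θ : Fin (n + 1) → ℤ) (p : Fin (n + 1) → Equiv.Perm (Fin m) × (Fin m → Fin K))
    (hθ : StrictMono θ) (hdom : ∀ k, IsDominant d v ε (θ k) (p k))
    (halt : ∀ k : Fin n, termSign ε (p k.castSucc) * termSign ε (p k.succ) < 0)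
    (horb : ∀ k : Fin n, ∀ b : Fin m, ∃ T : Finset (Fin m), b ∈ T ∧ T.card ≤ c ∧
      ∀ x, ((p k.castSucc).1⁻¹ * (p k.succ).1) x ∈ T ↔ x ∈ T) :
    (n : ℤ) ≤ m * (U₁ - U₀) :=
  chain_le d v ε c u hu U₀ U₁ hU θ p hθ hdom (ne_of_alt ε p halt) horb

/-! ### Short steps give short orbits -/

/-- **The changed set of a step is invariant; unchanged columns are fixed.**  If a step changes at most `ℓ ≥ 1` columns (in row or class),
every column lies in an invariant set of at most `ℓ` columns: the changed set (for a changed column) or the singleton (for an unchanged one).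
[this file] -/
theorem exists_invariant_of_shortStep (ℓ : ℕ) (hℓ : 1 ≤ ℓ) (p₁ p₂ : Equiv.Perm (Fin m) × (Fin m → Fin K))
    (hstep : (univ.filter fun i : Fin m => p₁.1 i ≠ p₂.1 i ∨ p₁.2 i ≠ p₂.2 i).card ≤ ℓ) (b : Fin m) :
    ∃ T : Finset (Fin m), b ∈ T ∧ T.card ≤ ℓ ∧ ∀ x, (p₁.1⁻¹ * p₂.1) x ∈ T ↔ x ∈ T := by
  classical
  set C := univ.filter fun i : Fin m => p₁.1 i ≠ p₂.1 i ∨ p₁.2 i ≠ p₂.2 i with hC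
  -- a column whose row does not change is a fixed point of the quotient
  have hfix : ∀ x : Fin m, p₁.1 x = p₂.1 x → (p₁.1⁻¹ * p₂.1) x = x := by
    intro x hx
    rw [Equiv.Perm.mul_apply, ← hx]
    simp
  -- the quotient maps row-changed columns to row-changed columns
  have he1 : ∀ x : Fin m, p₁.1 ((p₁.1⁻¹ * p₂.1) x) = p₂.1 x := by
    intro x
    simp [Equiv.Perm.mul_apply]
  have hmove : ∀ x : Fin m, p₁.1 x ≠ p₂.1 x → p₁.1 ((p₁.1⁻¹ * p₂.1) x) ≠ p₂.1 ((p₁.1⁻¹ * p₂.1) x) := by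
    intro x hx heq
    rw [he1 x] at heq
    -- heq : p₂.1 x = p₂.1 ((p₁.1⁻¹ * p₂.1) x)
    have h1 : x = (p₁.1⁻¹ * p₂.1) x := p₂.1.injective heq
    have h2 := congrArg p₁.1 h1
    rw [he1 x] at h2
    exact hx h2
  have hCinv : ∀ x, (p₁.1⁻¹ * p₂.1) x ∈ C ↔ x ∈ C := by
    intro x
    by_cases hx : p₁.1 x = p₂.1 x
    · rw [hfix x hx]
    · constructor
      · intro _; exact mem_filter.mpr ⟨mem_univ _, Or.inl hx⟩
      · intro _; exact mem_filter.mpr ⟨mem_univ _, Or.inl (hmove x hx)⟩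
  by_cases hb : b ∈ C
  · exact ⟨C, hb, hstep, hCinv⟩
  · refine ⟨{b}, mem_singleton_self b, by rw [card_singleton]; exact hℓ, fun x => ?_⟩
    have hb' : p₁.1 b = p₂.1 b := by
      by_contra h
      exact hb (mem_filter.mpr ⟨mem_univ _, Or.inl h⟩)
    rw [mem_singleton, mem_singleton]
    constructor
    · intro hx
      by_cases hxr : p₁.1 x = p₂.1 x
      · rwa [hfix x hxr] at hx
      · exact absurd (hx ▸ hmove x hxr) (not_not.mpr hb')
    · intro hx
      rw [hx, hfix b hb']

open Classical in
/-- **Orbits are invariant.**  The hypothesis of the law from a bound on ORBIT sizes: if the `σ₁⁻¹σ₂`-orbit of every column has at most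
`c` columns, every column lies in an invariant set of at most `c` columns (its orbit). [folklore] -/
theorem exists_invariant_of_orbit (c : ℕ) (τ : Equiv.Perm (Fin m))
    (horb : ∀ b : Fin m, (univ.filter fun x : Fin m => τ.SameCycle b x).card ≤ c) (b : Fin m) :
    ∃ T : Finset (Fin m), b ∈ T ∧ T.card ≤ c ∧ ∀ x, τ x ∈ T ↔ x ∈ T := by
  refine ⟨univ.filter fun x : Fin m => τ.SameCycle b x, ?_, horb b, fun x => ?_⟩
  · exact mem_filter.mpr ⟨mem_univ _, Equiv.Perm.SameCycle.refl τ b⟩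
  · simp only [mem_filter, mem_univ, true_and]
    exact Equiv.Perm.sameCycle_apply_right

end Chain

/-! ## 4. The `c`-lacunary instance -/

section Lacunary

variable {m K : ℕ} (d : Fin K → ℕ) (v ε : Fin m → Fin m → Fin K → ℤ)

/-- `m·((c+1)^(K−1) − 1)` in `ℤ` is the natural number `m·((c+1)^(K−1) − 1)`. [arithmetic] -/
theorem cast_height (m c K : ℕ) :
    (m : ℤ) * (((c + 1) ^ (K - 1) : ℕ) - (1 : ℕ) : ℤ) = ((m * ((c + 1) ^ (K - 1) - 1) : ℕ) : ℤ) := by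
  have h : 1 ≤ (c + 1) ^ (K - 1) := Nat.one_le_pow _ _ (Nat.succ_pos c)
  push_cast [Nat.cast_sub h]
  ring

/-- **CYCLE POTENTIAL LAW, `c`-lacunary exponents.**  If the exponent values are `c`-lacunary (`d l < d l' ⇒ c·d l < d l'`), every chain of
terms dominant at strictly increasing slopes with consecutive terms distinct, all of whose consecutive exchange quotients have orbits of size `≤ c`,
has `n ≤ m·((c+1)^(K−1) − 1)` — in ANY design with these exponents. [this file] -/
theorem chain_le_lacunary (c : ℕ) (hd : ∀ l l', d l < d l' → c * d l < d l')
    {n : ℕ} (θ : Fin (n + 1) → ℤ) (p : Fin (n + 1) → Equiv.Perm (Fin m) × (Fin m → Fin K))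
    (hθ : StrictMono θ) (hdom : ∀ k, IsDominant d v ε (θ k) (p k)) (hne : ∀ k : Fin n, p k.castSucc ≠ p k.succ)
    (horb : ∀ k : Fin n, ∀ b : Fin m, ∃ T : Finset (Fin m), b ∈ T ∧ T.card ≤ c ∧
      ∀ x, ((p k.castSucc).1⁻¹ * (p k.succ).1) x ∈ T ↔ x ∈ T) :
    n ≤ m * ((c + 1) ^ (K - 1) - 1) := by
  obtain ⟨u, hU, hu⟩ := exists_compatible_potential (m := m) c d hd
  have h := chain_le d v ε c u hu ((1 : ℕ) : ℤ) (((c + 1) ^ (K - 1) : ℕ) : ℤ)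
    (fun l => ⟨by exact_mod_cast (hU l).1, (hU l).2⟩) θ p hθ hdom hne horb
  rw [cast_height] at h
  exact_mod_cast h

/-- **`c`-lacunary exponents, short steps.**  If the exponent values are `c`-lacunary (`1 ≤ c`) and every step of the chain changes at most `c`
columns (in row or class), then `n ≤ m·((c+1)^(K−1) − 1)`.  Generalises `TropicalCensus.steps_le_of_shortSteps` (…TropicalBShortSteps:
exponents super-increasing by the size `m`, bound `m(ℓ+1)^K`) for `ℓ ≤ m`. [this file] -/
theorem chain_le_lacunary_of_shortSteps (c : ℕ) (hc : 1 ≤ c) (hd : ∀ l l', d l < d l' → c * d l < d l')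
    {n : ℕ} (θ : Fin (n + 1) → ℤ) (p : Fin (n + 1) → Equiv.Perm (Fin m) × (Fin m → Fin K))
    (hθ : StrictMono θ) (hdom : ∀ k, IsDominant d v ε (θ k) (p k)) (hne : ∀ k : Fin n, p k.castSucc ≠ p k.succ)
    (hstep : ∀ k : Fin n, (univ.filter fun i : Fin m =>
      (p k.castSucc).1 i ≠ (p k.succ).1 i ∨ (p k.castSucc).2 i ≠ (p k.succ).2 i).card ≤ c) :
    n ≤ m * ((c + 1) ^ (K - 1) - 1) :=
  chain_le_lacunary d v ε c hd θ p hθ hdom hne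
    fun k b => exists_invariant_of_shortStep c hc (p k.castSucc) (p k.succ) (hstep k) b

/-- **`c`-lacunary exponents, with exceptions.**  If all steps outside `J` have orbits of size `≤ c`, then
`n + 1 ≤ (#J + 1)·(m·((c+1)^(K−1) − 1) + 1)`; i.e. a chain of `n + 1` terms in a `c`-lacunary design has at least
`(n+1)/(m((c+1)^(K−1)−1)+1) − 1` steps whose exchange quotient has an orbit of more than `c` columns. [this file] -/
theorem chain_le_lacunary_of_exceptions (c : ℕ) (hd : ∀ l l', d l < d l' → c * d l < d l')
    {n : ℕ} (θ : Fin (n + 1) → ℤ) (p : Fin (n + 1) → Equiv.Perm (Fin m) × (Fin m → Fin K))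
    (hθ : StrictMono θ) (hdom : ∀ k, IsDominant d v ε (θ k) (p k)) (hne : ∀ k : Fin n, p k.castSucc ≠ p k.succ)
    (J : Finset (Fin n))
    (horb : ∀ k : Fin n, k ∉ J → ∀ b : Fin m, ∃ T : Finset (Fin m), b ∈ T ∧ T.card ≤ c ∧
      ∀ x, ((p k.castSucc).1⁻¹ * (p k.succ).1) x ∈ T ↔ x ∈ T) :
    n + 1 ≤ (J.card + 1) * (m * ((c + 1) ^ (K - 1) - 1) + 1) := by
  obtain ⟨u, hU, hu⟩ := exists_compatible_potential (m := m) c d hd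
  have h := chain_le_of_exceptions d v ε c u hu ((1 : ℕ) : ℤ) (((c + 1) ^ (K - 1) : ℕ) : ℤ)
    (fun l => ⟨by exact_mod_cast (hU l).1, (hU l).2⟩) θ p hθ hdom hne J horb
  rw [cast_height] at h
  exact_mod_cast h

/-- **Sign-alternating form** (hypothesis list of `TropicalCensus.TropRootLawAt`): `c`-lacunary exponents, steps changing `≤ c` columns
⇒ `n ≤ m·((c+1)^(K−1) − 1)`. [this file] -/
theorem chain_le_lacunary_of_shortSteps_alt (c : ℕ) (hc : 1 ≤ c) (hd : ∀ l l', d l < d l' → c * d l < d l')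
    {n : ℕ} (θ : Fin (n + 1) → ℤ) (p : Fin (n + 1) → Equiv.Perm (Fin m) × (Fin m → Fin K))
    (hθ : StrictMono θ) (hdom : ∀ k, IsDominant d v ε (θ k) (p k))
    (halt : ∀ k : Fin n, termSign ε (p k.castSucc) * termSign ε (p k.succ) < 0)
    (hstep : ∀ k : Fin n, (univ.filter fun i : Fin m =>
      (p k.castSucc).1 i ≠ (p k.succ).1 i ∨ (p k.castSucc).2 i ≠ (p k.succ).2 i).card ≤ c) :
    n ≤ m * ((c + 1) ^ (K - 1) - 1) :=
  chain_le_lacunary_of_shortSteps d v ε c hc hd θ p hθ hdom (ne_of_alt ε p halt) hstep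

end Lacunary

end CyclePotential

end Summit.ValiantsHypothesis.ValiantsHypothesis.Theorems.KPlusLogSqLaw
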